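import Summits.HubbardSuperconductivity.HubbardSuperconductivity.Theorems.AnisotropyChordTransferFibre3RowDProfile

/-!
# Route `AnisotropyChord` / H0 rotor rung: PartN41-D §4 — `SlotSpecs` PROVED (the factor specs of the two slot profiles)

Theory-1 g22's PartN41-D §4 `SlotSpecs` (port …Fibre3KT2aRow): for the ground profile, `Wfac w q · f̂_JU(q) = F_(w, a, −a, 0)(q)` and
`Wfac w q · f̂_S(q) = F_(w, 1 − a + a/V, 0, −c_s)(q)` — immediate from `profileTransforms_holds` (…RowDProfile).
★ `slotSpecs_holds (Δ) : SlotSpecs L Δ`.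
Prover seat `hubbard-h0-rotor-p1` g27 (route lead); helper for stmt-HubbardSuperconductivity-23918 (`--supports`, helper class).
WHAT THIS IS NOT: nothing here proves superconductivity in the Hubbard model.  Tree imports only; no new definitions; no sorry.
-/

set_option linter.dupNamespace false
set_option autoImplicit false

noncomputable section

open scoped BigOperators

namespace Summit.HubbardSuperconductivity.HubbardSuperconductivity.Theorems.AnisotropyChord.Transfer.Fibre3

variable (L : ℕ) [NeZero L]

/-- ★ **`SlotSpecs L Δ` holds.** [folklore] -/
theorem slotSpecs_holds (Δ : ℝ) : SlotSpecs L Δ := by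
  intro lam2 f hL hΔ0 hΔ1 hf w q
  obtain ⟨hJU, hS, -⟩ := profileTransforms_holds L Δ lam2 f hL hΔ0 hΔ1 hf q
  have hV : ((L : ℝ)) ^ 2 ≠ 0 := by
    have : (0 : ℝ) < L := by exact_mod_cast (show 0 < L by omega)
    positivity
  unfold Ffac
  simp only
  constructor
  · rw [hJU]
    congr 1
    push_cast
    split_ifs <;> ring
  · rw [hS]
    congr 1
    have e : (1 - Δ * f (K1 L) + Δ * f (K1 L) / (L : ℝ) ^ 2) * (L : ℝ) ^ 2
        = (L : ℝ) ^ 2 * (1 - Δ * f (K1 L)) + Δ * f (K1 L) := by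
      field_simp
    push_cast
    split_ifs
    · rw [e]; push_cast; ring
    · ring

end Summit.HubbardSuperconductivity.HubbardSuperconductivity.Theorems.AnisotropyChord.Transfer.Fibre3

end
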